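import Literature.NumberTheory.Sieve.LinearEquationsInPrimesSieveWeights
import HarnessLib

/-!
# The enveloping sieve: local densities at a prime (Green–Tao 2010, App. D)

Trunk T-SIEVE (`Literature/NumberTheory/Sieve`). Second file of the App. D layer of the
decomposition of `Literature.NumberTheory.Sieve.GreenTaoZiegler2012_finiteComplexity` (towards Prop. 6.4 via the
Goldston–Yıldırım estimate, Thm. D.3, of B. Green, T. Tao, *Linear equations in primes*,
Ann. of Math. 171 (2010)). The Euler factors `E_p` of the proof of Thm. D.3 (p. 45 of
arXiv:math/0606088) are built from the local densities `α(p, B) = α_{p^{r_1},…,p^{r_t}}`; this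
file identifies them with densities over `ℤ_p^d` and records their sizes ("Lemma 1.3"-type
bounds, from the counting lemmas of `LinearEquationsInPrimesProofs.lean`):

* `Literature.NumberTheory.Sieve.expect_comp_castHom` — averages over `ℤ_M^d` of functions of the reduction mod `p ∣ M`;
* `Literature.primeDensity Ψ S p = 𝔼_{ℤ_p^d} ∏_{i ∈ S} 1_{ψ_i ≡ 0}` and
  `Literature.localDensity_primeModuli : α_{(p on S, 1 off S)} = α(p, S)`;
* `α(p, ∅) = 1`, `α(p, {i}) = 1/p` for `ψ̇_i ≢ 0 (p)` (vertical `B`), `α(p, S) ≤ 1/p²` when `S`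
  contains two forms with a non-zero `2 × 2` minor mod `p`, `α(p, S) ≤ 1/p` in general;
* the exceptional primes `P_Ψ` (`Literature.NumberTheory.Sieve.IsExceptionalPrime`: two forms linearly dependent modulo `p`
  as vectors of `𝔽_p^{d+1}`) and `α(p, S) ≤ 1/p²` for `p ∉ P_Ψ` and `|S| ≥ 2`
  (`Literature.NumberTheory.Sieve.primeDensity_le_of_not_exceptional`: parallel homogeneous parts force an empty common
  zero set); every exceptional prime divides a non-zero minor when no two forms are rational
  multiples of one another (`Literature.NumberTheory.Sieve.exceptionalPrime_le`, so `P_Ψ` is finite).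

## References

* B. Green, T. Tao, *Linear equations in primes*, Ann. of Math. (2) 171 (2010), 1753–1850
  (arXiv:math/0606088), App. D, proof of Thm. D.3 (the paragraph "Call a set `B ⊆ Ω`
  vertical …" on `α(p,B)`), and Lemma 1.3.
-/

noncomputable section

open Finset
open scoped BigOperators

namespace Literature.NumberTheory.Sieve

/-- `modEval` commutes with ring homomorphisms, `RingHomClass` version of `Literature.NumberTheory.Sieve.map_modEval`.
[folklore] -/
theorem map_modEval' {d M M' : ℕ} {F : Type*} [FunLike F (ZMod M) (ZMod M')]
    [RingHomClass F (ZMod M) (ZMod M')] (f : F) (ψ : AffLinForm d) (v : Fin d → ZMod M) :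
    f (ψ.modEval M v) = ψ.modEval M' (fun j => f (v j)) := by
  unfold AffLinForm.modEval
  rw [map_add, map_sum, map_intCast]
  congr 1
  exact Finset.sum_congr rfl fun j _ => by rw [map_mul, map_intCast]

/-! ### Local densities at a prime -/

section primedensity

variable {d t : ℕ}

/-- Averages of functions of the reduction modulo `p ∣ M` over `ℤ_M^d` are averages over `ℤ_p^d`
(the reduction has uniform fibres). [folklore] -/
theorem expect_comp_castHom {M p : ℕ} [NeZero M] [NeZero p] (h : p ∣ M)
    (F : (Fin d → ZMod p) → ℝ) :
    𝔼 r : Fin d → ZMod M, F (fun j => ZMod.castHom h (ZMod p) (r j)) = 𝔼 v : Fin d → ZMod p, F v := by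
  classical
  set Φ : (Fin d → ZMod M) →+ (Fin d → ZMod p) :=
    AddMonoidHom.compLeft (ZMod.castHom h (ZMod p)).toAddMonoidHom (Fin d) with hΦ
  have hΦapp : ∀ r : Fin d → ZMod M, Φ r = fun j => ZMod.castHom h (ZMod p) (r j) := fun r => rfl
  have hsurj : Function.Surjective Φ := fun v => by
    choose g hg using fun j => ZMod.castHom_surjective h (v j)
    exact ⟨g, funext fun j => by rw [hΦapp]; exact hg j⟩
  have hfib := card_fiber_mul_card_of_surjective Φ hsurj
  rw [Fintype.expect_eq_sum_div_card, Fintype.expect_eq_sum_div_card]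
  rw [← Finset.sum_fiberwise_of_maps_to (g := Φ) (t := Finset.univ) (fun _ _ => Finset.mem_univ _)]
  have hcardM : (Fintype.card (Fin d → ZMod M) : ℝ) =
      (({g | Φ g = (0 : Fin d → ZMod p)} : Finset _).card : ℝ) * Fintype.card (Fin d → ZMod p) := by
    exact_mod_cast (hfib 0).symm
  have hconst : ∀ v : Fin d → ZMod p, (({g | Φ g = v} : Finset _).card : ℝ) =
      (({g | Φ g = (0 : Fin d → ZMod p)} : Finset _).card : ℝ) := fun v => by
    have h1 := hfib v; have h0 := hfib 0
    have hc : (Fintype.card (Fin d → ZMod p)) ≠ 0 := Fintype.card_ne_zero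
    exact_mod_cast Nat.eq_of_mul_eq_mul_right (Nat.pos_of_ne_zero hc) (h1.trans h0.symm)
  have hinner : ∀ v : Fin d → ZMod p, ∑ r ∈ (Finset.univ.filter fun r => Φ r = v),
      F (fun j => ZMod.castHom h (ZMod p) (r j)) =
      (({g | Φ g = (0 : Fin d → ZMod p)} : Finset _).card : ℝ) * F v := by
    intro v
    rw [Finset.sum_congr rfl fun r hr => by rw [← hΦapp, (Finset.mem_filter.mp hr).2],
      Finset.sum_const, nsmul_eq_mul, hconst v]
  simp_rw [hinner]
  rw [← Finset.mul_sum, hcardM, mul_div_mul_left]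
  have : (({g | Φ g = (0 : Fin d → ZMod p)} : Finset _).card : ℝ) ≠ 0 := by
    have h0 := hfib 0
    intro hz
    have hz' : ({g | Φ g = (0 : Fin d → ZMod p)} : Finset _).card = 0 := by exact_mod_cast hz
    rw [hz', zero_mul] at h0
    exact Fintype.card_ne_zero h0.symm
  exact this

/-- The local density of simultaneous divisibility by a prime: `α(p, S) = 𝔼_{v ∈ ℤ_p^d} ∏_{i∈S} 1_{ψ_i(v) = 0}`.
[cite: GreenTao2010, App. D (proof of Thm. D.3, `α(p,B) := α_{p^{r_1},…,p^{r_t}}`)] -/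
def primeDensity (Ψ : Fin t → AffLinForm d) (S : Finset (Fin t)) (p : ℕ) [NeZero p] : ℝ :=
  𝔼 v : Fin d → ZMod p, ∏ i ∈ S, if (Ψ i).modEval p v = 0 then (1 : ℝ) else 0

open Classical in
/-- `α(p, S)` as a normalised count. [folklore] -/
theorem primeDensity_eq_card (Ψ : Fin t → AffLinForm d) (S : Finset (Fin t)) (p : ℕ) [NeZero p] :
    primeDensity Ψ S p =
      ((Finset.univ.filter fun v : Fin d → ZMod p => ∀ i ∈ S, (Ψ i).modEval p v = 0).card : ℝ) /
        (p : ℝ) ^ d := by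
  unfold primeDensity
  rw [Fintype.expect_eq_sum_div_card, card_zmod_pow, Nat.cast_pow]
  congr 1
  rw [Finset.card_filter]
  push_cast
  refine Finset.sum_congr rfl fun v _ => ?_
  rw [Finset.prod_ite_zero, Finset.prod_const_one]
  by_cases h : ∀ i ∈ S, (Ψ i).modEval p v = 0 <;> simp [h]

/-- `α(p, ∅) = 1`. [cite: GreenTao2010, App. D ("Note that `α(p,∅) = 1`")] -/
theorem primeDensity_empty (Ψ : Fin t → AffLinForm d) (p : ℕ) [NeZero p] : primeDensity Ψ ∅ p = 1 := by
  unfold primeDensity; simp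

/-- `0 ≤ α(p, S) ≤ 1`. [folklore] -/
theorem primeDensity_nonneg (Ψ : Fin t → AffLinForm d) (S : Finset (Fin t)) (p : ℕ) [NeZero p] :
    0 ≤ primeDensity Ψ S p :=
  Finset.expect_nonneg fun v _ => Finset.prod_nonneg fun i _ => by split_ifs <;> norm_num

/-- Monotonicity: `α(p, S) ≤ α(p, S')` for `S' ⊆ S`. [folklore] -/
theorem primeDensity_mono (Ψ : Fin t → AffLinForm d) {S S' : Finset (Fin t)} (h : S' ⊆ S) (p : ℕ)
    [NeZero p] : primeDensity Ψ S p ≤ primeDensity Ψ S' p := by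
  unfold primeDensity
  refine Finset.expect_le_expect fun v _ => ?_
  classical
  rw [← Finset.prod_sdiff h]
  refine mul_le_of_le_one_left (Finset.prod_nonneg fun i _ => by split_ifs <;> norm_num)
    (Finset.prod_le_one (fun i _ => by split_ifs <;> norm_num) fun i _ => by split_ifs <;> norm_num)

/-- **One form** (vertical `B`): `α(p, {i}) = 1/p` when `ψ̇_i ≢ 0 (mod p)`.
[cite: GreenTao2010, App. D ("If `B` is vertical then `α(p,B) = 𝔼 1_{p | ψ_i(n)}`, which is
equal to `1/p`")] -/
theorem primeDensity_singleton {p : ℕ} [Fact p.Prime] (Ψ : Fin t → AffLinForm d) (i : Fin t)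
    (hψ : (fun j => ((Ψ i).coeff j : ZMod p)) ≠ 0) : primeDensity Ψ {i} p = 1 / p := by
  classical
  have hp : (p : ℝ) ≠ 0 := by exact_mod_cast (Fact.out : p.Prime).ne_zero
  rw [primeDensity_eq_card]
  have h := card_modZero_mul (Ψ i) hψ
  have h' : (((Finset.univ.filter fun v : Fin d → ZMod p => (Ψ i).modEval p v = 0).card : ℕ) : ℝ) * p =
      (p : ℝ) ^ d := by exact_mod_cast h
  have hset : (Finset.univ.filter fun v : Fin d → ZMod p => ∀ i' ∈ ({i} : Finset (Fin t)), (Ψ i').modEval p v = 0) =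
      Finset.univ.filter fun v : Fin d → ZMod p => (Ψ i).modEval p v = 0 := by
    ext v; simp
  rw [hset, div_eq_div_iff (pow_ne_zero d hp) hp, one_mul]
  exact h'

/-- **Two independent forms** (`B` neither empty nor vertical, `p ∉ P_Ψ`): if `S ∋ i ≠ i'` and some
`2 × 2` minor of `(ψ̇_i, ψ̇_{i'})` is `≢ 0 (mod p)` then `α(p, S) ≤ 1/p²`.
[cite: GreenTao2010, App. D ("For `p ∉ P_Ψ`, we see from Lemma 1.3 that `α(p,B) = O(1/p²)`
whenever `B` is not vertical or empty")] -/
theorem primeDensity_le_of_minor {p : ℕ} [Fact p.Prime] (Ψ : Fin t → AffLinForm d) {S : Finset (Fin t)}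
    {i i' : Fin t} (hi : i ∈ S) (hi' : i' ∈ S) (k l : Fin d)
    (hD : (((Ψ i).coeff k * (Ψ i').coeff l - (Ψ i).coeff l * (Ψ i').coeff k : ℤ) : ZMod p) ≠ 0) :
    primeDensity Ψ S p ≤ 1 / (p : ℝ) ^ 2 := by
  classical
  have hii' : i ≠ i' := by rintro rfl; exact hD (by push_cast; ring)
  have hp : (p : ℝ) ≠ 0 := by exact_mod_cast (Fact.out : p.Prime).ne_zero
  have hsub : ({i, i'} : Finset (Fin t)) ⊆ S := by
    intro x hx; rcases Finset.mem_insert.mp hx with rfl | hx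
    · exact hi
    · rw [Finset.mem_singleton.mp hx]; exact hi'
  refine (primeDensity_mono Ψ hsub p).trans ?_
  rw [primeDensity_eq_card]
  have h := card_modZero_pair_mul (Ψ i) (Ψ i') k l hD
  have h' : (((Finset.univ.filter fun v : Fin d → ZMod p =>
      (Ψ i).modEval p v = 0 ∧ (Ψ i').modEval p v = 0).card : ℕ) : ℝ) * (p : ℝ) ^ 2 = (p : ℝ) ^ d := by
    exact_mod_cast h
  have hset : (Finset.univ.filter fun v : Fin d → ZMod p =>
      ∀ x ∈ ({i, i'} : Finset (Fin t)), (Ψ x).modEval p v = 0) =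
      Finset.univ.filter fun v : Fin d → ZMod p => (Ψ i).modEval p v = 0 ∧ (Ψ i').modEval p v = 0 := by
    ext v; simp
  rw [hset, div_le_div_iff₀ (by positivity) (by positivity), one_mul]
  exact h'.le

/-- **One form among several** (`p` possibly exceptional): if `i ∈ S` and `ψ̇_i ≢ 0 (mod p)` then
`α(p, S) ≤ 1/p`. [cite: GreenTao2010, App. D ("If `p ∈ P_Ψ` then the best we can say in general
is that `α(p,B) = O(1/p)`")] -/
theorem primeDensity_le_of_mem {p : ℕ} [Fact p.Prime] (Ψ : Fin t → AffLinForm d) {S : Finset (Fin t)}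
    {i : Fin t} (hi : i ∈ S) (hψ : (fun j => ((Ψ i).coeff j : ZMod p)) ≠ 0) :
    primeDensity Ψ S p ≤ 1 / p := by
  rw [← primeDensity_singleton Ψ i hψ]
  exact primeDensity_mono Ψ (Finset.singleton_subset_iff.mpr hi) p

/-- The moduli `(p on S, 1 off S)`. [folklore] -/
def primeModuli (S : Finset (Fin t)) (p : ℕ) (i : Fin t) : ℕ := if i ∈ S then p else 1

/-- `∏ primeModuli = p^{|S|}`. [folklore] -/
theorem prod_primeModuli (S : Finset (Fin t)) (p : ℕ) : ∏ i, primeModuli S p i = p ^ S.card := by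
  classical
  unfold primeModuli
  rw [Finset.prod_ite_mem, Finset.univ_inter, Finset.prod_const]

/-- A divisibility indicator modulo `m = p` read in `ℤ_p` through the canonical identification.
[folklore] -/
theorem indicator_primeModuli_mem {M : ℕ} (Ψ : Fin t → AffLinForm d) {S : Finset (Fin t)} {p : ℕ}
    {i : Fin t} (hi : i ∈ S) (hdvd : primeModuli S p i ∣ M) (hpM : p ∣ M) (r : Fin d → ZMod M) :
    ((Ψ i).modEval (primeModuli S p i) fun j => ZMod.castHom hdvd (ZMod (primeModuli S p i)) (r j)) = 0 ↔
      ((Ψ i).modEval p fun j => ZMod.castHom hpM (ZMod p) (r j)) = 0 := by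
  have h : primeModuli S p i = p := if_pos hi
  let φ : ZMod (primeModuli S p i) ≃+* ZMod p := ZMod.ringEquivCongr h
  rw [← φ.injective.eq_iff, map_zero, map_modEval' φ]
  have hcomp : ∀ x : ZMod M, φ (ZMod.castHom hdvd (ZMod (primeModuli S p i)) x) =
      ZMod.castHom hpM (ZMod p) x := fun x => by
    have := Subsingleton.elim (φ.toRingHom.comp (ZMod.castHom hdvd (ZMod (primeModuli S p i))))
      (ZMod.castHom hpM (ZMod p))
    have h' := RingHom.congr_fun this x
    simpa using h'
  simp_rw [hcomp]

/-- A divisibility indicator modulo `m = 1` is trivially satisfied. [folklore] -/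
theorem indicator_primeModuli_not_mem {M : ℕ} (Ψ : Fin t → AffLinForm d) {S : Finset (Fin t)} {p : ℕ}
    {i : Fin t} (hi : i ∉ S) (hdvd : primeModuli S p i ∣ M) (r : Fin d → ZMod M) :
    ((Ψ i).modEval (primeModuli S p i) fun j => ZMod.castHom hdvd (ZMod (primeModuli S p i)) (r j)) = 0 := by
  have h : primeModuli S p i = 1 := if_neg hi
  haveI : Subsingleton (ZMod (primeModuli S p i)) := by rw [h]; infer_instance
  exact Subsingleton.elim _ _

/-- **Local densities at prime-patterned moduli are the prime densities**:
`α_{(p on S, 1 off S)} = α(p, S)`. [cite: GreenTao2010, App. D (proof of Thm. D.3,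
"`α(p,B) := α_{p^{r_1},…,p^{r_t}}`")] -/
theorem localDensity_primeModuli (Ψ : Fin t → AffLinForm d) (S : Finset (Fin t)) {p : ℕ} [NeZero p]
    [NeZero (∏ i, primeModuli S p i)] :
    localDensity Ψ (primeModuli S p) = primeDensity Ψ S p := by
  classical
  rcases S.eq_empty_or_nonempty with rfl | hne
  · -- all moduli are `1`
    rw [primeDensity_empty]
    unfold localDensity
    have : ∀ r : Fin d → ZMod (∏ i, primeModuli (∅ : Finset (Fin t)) p i),
        divWeight Ψ (primeModuli ∅ p) r = 1 := fun r => by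
      unfold divWeight
      refine Finset.prod_eq_one fun i _ => ?_
      rw [if_pos (indicator_primeModuli_not_mem Ψ (Finset.notMem_empty i) _ r)]
    simp_rw [this]
    exact Fintype.expect_const _
  · have hpM : p ∣ ∏ i, primeModuli S p i := by
      rw [prod_primeModuli]; exact dvd_pow_self p hne.card_pos.ne'
    have hw : ∀ r : Fin d → ZMod (∏ i, primeModuli S p i), divWeight Ψ (primeModuli S p) r =
        ∏ i ∈ S, if ((Ψ i).modEval p fun j => ZMod.castHom hpM (ZMod p) (r j)) = 0 then (1 : ℝ) else 0 := by
      intro r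
      unfold divWeight
      rw [← Finset.prod_filter_mul_prod_filter_not Finset.univ (fun i => i ∈ S)]
      have h1 : (Finset.univ.filter fun i : Fin t => i ∈ S) = S := by ext i; simp
      rw [h1]
      have h2 : ∏ i ∈ Finset.univ.filter (fun i : Fin t => ¬ i ∈ S),
          (if ((Ψ i).modEval (primeModuli S p i) fun j =>
            ZMod.castHom (Finset.dvd_prod_of_mem (primeModuli S p) (Finset.mem_univ i))
              (ZMod (primeModuli S p i)) (r j)) = 0 then (1 : ℝ) else 0) = 1 :=
        Finset.prod_eq_one fun i hi => by
          rw [if_pos (indicator_primeModuli_not_mem Ψ (Finset.mem_filter.mp hi).2 _ r)]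
      rw [h2, mul_one]
      refine Finset.prod_congr rfl fun i hi => ?_
      simp only [indicator_primeModuli_mem Ψ hi _ hpM r]
    unfold localDensity
    simp_rw [hw]
    unfold primeDensity
    exact expect_comp_castHom hpM (fun v => ∏ i ∈ S, if (Ψ i).modEval p v = 0 then (1 : ℝ) else 0)

/-! ### Exceptional primes -/

/-- The affine form `ψ` as a vector of `𝔽_p^{d+1}` (coefficients, then the constant). [folklore] -/
def affVecMod (ψ : AffLinForm d) (p : ℕ) : Fin (d + 1) → ZMod p :=
  Fin.snoc (fun j => (ψ.coeff j : ZMod p)) (ψ.const : ZMod p)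

/-- Two forms are *linearly dependent modulo `p`* if their vectors in `𝔽_p^{d+1}` are
(`a ψ_i = b ψ_j` for some `(a, b) ≠ (0, 0)`). [cite: GreenTao2010, Thm. D.3 ("Call a prime `p`
exceptional if there exist two forms `ψ_i, ψ_j` which are linearly dependent modulo `p`")] -/
def LinDepMod (ψ φ : AffLinForm d) (p : ℕ) : Prop :=
  ∃ a b : ZMod p, (a ≠ 0 ∨ b ≠ 0) ∧ a • affVecMod ψ p = b • affVecMod φ p

/-- The exceptional primes `P_Ψ` of a system. [cite: GreenTao2010, Thm. D.3] -/
def IsExceptionalPrime (Ψ : Fin t → AffLinForm d) (p : ℕ) : Prop :=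
  p.Prime ∧ ∃ i j, i ≠ j ∧ LinDepMod (Ψ i) (Ψ j) p

/-- If `ψ̇ ≡ 0 (mod p)` then `ψ` is linearly dependent with every form modulo `p`… unless its
constant is non-zero; in any case `ψ ≡ 0 (mod p)` entirely makes `ψ` dependent with everything.
[folklore] -/
theorem linDepMod_of_affVecMod_eq_zero {ψ : AffLinForm d} {p : ℕ} [Fact p.Prime]
    (h : affVecMod ψ p = 0) (φ : AffLinForm d) : LinDepMod ψ φ p :=
  ⟨1, 0, Or.inl one_ne_zero, by rw [h, smul_zero, zero_smul]⟩

/-- **Non-exceptional pairs have few common zeros**: if `ψ, φ` are linearly independent modulo the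
prime `p`, then `#{v ∈ 𝔽_p^d : ψ(v) = φ(v) = 0} · p² ≤ p^d` (either the homogeneous parts are not
parallel — exactly `p^{d-2}` common zeros — or they are parallel and then there is no common zero).
[cite: GreenTao2010, App. D ("For `p ∉ P_Ψ`, we see from Lemma 1.3 that `α(p,B) = O(1/p²)`")] -/
theorem card_modZero_pair_le_of_not_linDepMod {p : ℕ} [Fact p.Prime] (ψ φ : AffLinForm d)
    (h : ¬ LinDepMod ψ φ p) :
    (Finset.univ.filter fun v : Fin d → ZMod p => ψ.modEval p v = 0 ∧ φ.modEval p v = 0).card * p ^ 2 ≤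
      p ^ d := by
  classical
  -- the homogeneous parts mod `p`
  set a : Fin d → ZMod p := fun j => (ψ.coeff j : ZMod p) with ha
  set b : Fin d → ZMod p := fun j => (φ.coeff j : ZMod p) with hb
  by_cases hminor : ∃ k l, a k * b l - a l * b k ≠ 0
  · obtain ⟨k, l, hkl⟩ := hminor
    have hD : ((ψ.coeff k * φ.coeff l - ψ.coeff l * φ.coeff k : ℤ) : ZMod p) ≠ 0 := by
      push_cast; exact hkl
    exact (card_modZero_pair_mul ψ φ k l hD).le
  · -- parallel homogeneous parts: no common zero (else the forms would be dependent mod `p`)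
    push Not at hminor
    suffices hempty : (Finset.univ.filter fun v : Fin d → ZMod p =>
        ψ.modEval p v = 0 ∧ φ.modEval p v = 0) = ∅ by
      rw [hempty, Finset.card_empty, zero_mul]; exact Nat.zero_le _
    rw [Finset.filter_eq_empty_iff]
    intro v _ ⟨hψv, hφv⟩
    apply h
    -- Case 1: `a = 0`.
    by_cases ha0 : a = 0
    · -- then `ψ ≡ ψ(0)` and `ψ(v) = 0` forces `ψ(0) ≡ 0`: `ψ ≡ 0 (mod p)`
      have hc : (ψ.const : ZMod p) = 0 := by
        have : ψ.modEval p v = (ψ.const : ZMod p) := by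
          unfold AffLinForm.modEval
          rw [Finset.sum_eq_zero (fun j _ => by rw [show (ψ.coeff j : ZMod p) = a j from rfl,
            ha0, Pi.zero_apply, zero_mul]), zero_add]
        rw [← this, hψv]
      refine linDepMod_of_affVecMod_eq_zero ?_ φ
      funext m
      unfold affVecMod
      refine Fin.lastCases ?_ (fun j => ?_) m
      · rw [Fin.snoc_last]; exact hc
      · rw [Fin.snoc_castSucc]; exact congr_fun ha0 j
    · -- Case 2: `a ≠ 0`, say `a k ≠ 0`; then `b = c • a` with `c = b k / a k`
      obtain ⟨k, hk⟩ : ∃ k, a k ≠ 0 := by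
        by_contra hh; push Not at hh; exact ha0 (funext hh)
      set c : ZMod p := b k * (a k)⁻¹ with hc
      have hbc : ∀ j, b j = c * a j := fun j => by
        have := hminor k j
        rw [sub_eq_zero] at this
        rw [hc]
        field_simp
        linear_combination this
      -- constants: `φ(v) = c ψ(v) + (φ(0) - c ψ(0))`, so `φ(0) = c ψ(0)`
      have hconst : (φ.const : ZMod p) = c * (ψ.const : ZMod p) := by
        have e1 : φ.modEval p v = c * ψ.modEval p v + ((φ.const : ZMod p) - c * (ψ.const : ZMod p)) := by
          unfold AffLinForm.modEval
          rw [mul_add, Finset.mul_sum]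
          have : ∑ j, (φ.coeff j : ZMod p) * v j = ∑ j, c * ((ψ.coeff j : ZMod p) * v j) :=
            Finset.sum_congr rfl fun j _ => by
              rw [show (φ.coeff j : ZMod p) = b j from rfl, hbc j, show (ψ.coeff j : ZMod p) = a j from rfl]
              ring
          rw [this]; ring
        rw [hψv, hφv, mul_zero, zero_add] at e1
        exact (sub_eq_zero.mp e1.symm)
      refine ⟨c, 1, Or.inr one_ne_zero, ?_⟩
      funext m
      simp only [Pi.smul_apply, smul_eq_mul, one_mul]
      unfold affVecMod
      refine Fin.lastCases ?_ (fun j => ?_) m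
      · rw [Fin.snoc_last, Fin.snoc_last, hconst]
      · rw [Fin.snoc_castSucc, Fin.snoc_castSucc]
        exact (hbc j).symm ▸ (by rw [show (φ.coeff j : ZMod p) = b j from rfl, hbc j])

/-- **`α(p, S) ≤ 1/p²` off the exceptional primes** for `S` containing two distinct indices.
[cite: GreenTao2010, App. D ("For `p ∉ P_Ψ` … `α(p,B) = O(1/p²)` whenever `B` is not vertical
or empty")] -/
theorem primeDensity_le_of_not_exceptional {p : ℕ} [Fact p.Prime] (Ψ : Fin t → AffLinForm d)
    {S : Finset (Fin t)} {i i' : Fin t} (hi : i ∈ S) (hi' : i' ∈ S) (hii' : i ≠ i')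
    (hp : ¬ IsExceptionalPrime Ψ p) : primeDensity Ψ S p ≤ 1 / (p : ℝ) ^ 2 := by
  classical
  have hnd : ¬ LinDepMod (Ψ i) (Ψ i') p := fun h => hp ⟨Fact.out, i, i', hii', h⟩
  have hsub : ({i, i'} : Finset (Fin t)) ⊆ S := by
    intro x hx; rcases Finset.mem_insert.mp hx with rfl | hx
    · exact hi
    · rw [Finset.mem_singleton.mp hx]; exact hi'
  refine (primeDensity_mono Ψ hsub p).trans ?_
  rw [primeDensity_eq_card]
  have h := card_modZero_pair_le_of_not_linDepMod (Ψ i) (Ψ i') hnd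
  have h' : (((Finset.univ.filter fun v : Fin d → ZMod p =>
      (Ψ i).modEval p v = 0 ∧ (Ψ i').modEval p v = 0).card : ℕ) : ℝ) * (p : ℝ) ^ 2 ≤ (p : ℝ) ^ d := by
    exact_mod_cast h
  have hset : (Finset.univ.filter fun v : Fin d → ZMod p =>
      ∀ x ∈ ({i, i'} : Finset (Fin t)), (Ψ x).modEval p v = 0) =
      Finset.univ.filter fun v : Fin d → ZMod p => (Ψ i).modEval p v = 0 ∧ (Ψ i').modEval p v = 0 := by
    ext v; simp
  have hp0 : (0 : ℝ) < p := by exact_mod_cast (Fact.out : p.Prime).pos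
  rw [hset, div_le_div_iff₀ (by positivity) (by positivity), one_mul]
  exact h'

/-- The affine form as an integer vector of length `d + 1`. [folklore] -/
def affVec (ψ : AffLinForm d) : Fin (d + 1) → ℤ := Fin.snoc ψ.coeff ψ.const

/-- `affVecMod` is the reduction of `affVec`. [folklore] -/
theorem affVecMod_eq (ψ : AffLinForm d) (p : ℕ) (m : Fin (d + 1)) :
    affVecMod ψ p m = ((affVec ψ m : ℤ) : ZMod p) := by
  unfold affVecMod affVec
  refine Fin.lastCases ?_ (fun j => ?_) m
  · rw [Fin.snoc_last, Fin.snoc_last]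
  · rw [Fin.snoc_castSucc, Fin.snoc_castSucc]

/-- Linear dependence modulo `p` kills all `2 × 2` minors modulo `p`. [folklore] -/
theorem minor_eq_zero_of_linDepMod {ψ φ : AffLinForm d} {p : ℕ} [Fact p.Prime] (h : LinDepMod ψ φ p)
    (k l : Fin (d + 1)) :
    ((affVec ψ k * affVec φ l - affVec ψ l * affVec φ k : ℤ) : ZMod p) = 0 := by
  obtain ⟨a, b, hab, heq⟩ := h
  have hk := congr_fun heq k
  have hl := congr_fun heq l
  simp only [Pi.smul_apply, smul_eq_mul, affVecMod_eq] at hk hl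
  push_cast
  rcases hab with ha | hb
  · have e1 : ((affVec ψ k : ℤ) : ZMod p) = a⁻¹ * (b * ((affVec φ k : ℤ) : ZMod p)) := by
      rw [← hk, ← mul_assoc, inv_mul_cancel₀ ha, one_mul]
    have e2 : ((affVec ψ l : ℤ) : ZMod p) = a⁻¹ * (b * ((affVec φ l : ℤ) : ZMod p)) := by
      rw [← hl, ← mul_assoc, inv_mul_cancel₀ ha, one_mul]
    rw [e1, e2]; ring
  · have e1 : ((affVec φ k : ℤ) : ZMod p) = b⁻¹ * (a * ((affVec ψ k : ℤ) : ZMod p)) := by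
      rw [hk, ← mul_assoc, inv_mul_cancel₀ hb, one_mul]
    have e2 : ((affVec φ l : ℤ) : ZMod p) = b⁻¹ * (a * ((affVec ψ l : ℤ) : ZMod p)) := by
      rw [hl, ← mul_assoc, inv_mul_cancel₀ hb, one_mul]
    rw [e1, e2]; ring

/-- **Exceptional primes divide a non-zero minor**: if `ψ_i, ψ_j` are not rational multiples of one
another (some `2 × 2` minor `D` of their integer vectors is non-zero) and are linearly dependent
modulo the prime `p`, then `p ∣ D`; in particular `P_Ψ` is finite when no two forms are rational
multiples of one another. [cite: GreenTao2010, App. D (Remarks after Thm. D.3: "This means that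
`P_Ψ` is finite but not necessarily bounded in terms of `t,d,L`")] -/
theorem dvd_minor_of_linDepMod {ψ φ : AffLinForm d} {p : ℕ} [Fact p.Prime] (h : LinDepMod ψ φ p)
    (k l : Fin (d + 1)) : (p : ℤ) ∣ affVec ψ k * affVec φ l - affVec ψ l * affVec φ k :=
  (ZMod.intCast_zmod_eq_zero_iff_dvd _ p).mp (minor_eq_zero_of_linDepMod h k l)

/-- A bound for the exceptional primes: if for all `i ≠ j` a non-zero minor `D i j` of
`(ψ_i, ψ_j)` is given, every exceptional prime divides `∏_{i ≠ j} |D i j|`, hence is at most this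
number. [folklore] -/
theorem exceptionalPrime_le (Ψ : Fin t → AffLinForm d) (kl : Fin t → Fin t → Fin (d + 1) × Fin (d + 1))
    (hD : ∀ i j, i ≠ j → affVec (Ψ i) (kl i j).1 * affVec (Ψ j) (kl i j).2 -
      affVec (Ψ i) (kl i j).2 * affVec (Ψ j) (kl i j).1 ≠ 0)
    {p : ℕ} (hp : IsExceptionalPrime Ψ p) :
    p ≤ ∏ ij ∈ (Finset.univ : Finset (Fin t × Fin t)).filter (fun ij => ij.1 ≠ ij.2),
      (affVec (Ψ ij.1) (kl ij.1 ij.2).1 * affVec (Ψ ij.2) (kl ij.1 ij.2).2 -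
        affVec (Ψ ij.1) (kl ij.1 ij.2).2 * affVec (Ψ ij.2) (kl ij.1 ij.2).1).natAbs := by
  obtain ⟨hpp, i, j, hij, hdep⟩ := hp
  haveI := Fact.mk hpp
  have hdvd := dvd_minor_of_linDepMod hdep (kl i j).1 (kl i j).2
  have hmem : (i, j) ∈ (Finset.univ : Finset (Fin t × Fin t)).filter (fun ij => ij.1 ≠ ij.2) :=
    Finset.mem_filter.mpr ⟨Finset.mem_univ _, hij⟩
  refine Nat.le_of_dvd (Finset.prod_pos fun ij hij' => ?_)
    ((Int.natCast_dvd.mp (Int.dvd_natAbs.mpr hdvd)).trans (Finset.dvd_prod_of_mem _ hmem))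
  exact Int.natAbs_pos.mpr (hD ij.1 ij.2 (Finset.mem_filter.mp hij').2)

end primedensity

end Literature.NumberTheory.Sieve
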